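import Literature.Analysis.FunctionSpaces.ContDiffHolderLeibniz
import HarnessLib

/-!
# The sharp Leibniz estimate in the `C^{k,r}` norms (one factor carries the Hölder exponent)

Analysis/FunctionSpaces support file (everything proved). `ContDiffHolderLeibniz.lean` proves the
Leibniz estimate for the accepted norms `eContDiffHolderNorm k r f = ∑_{j ≤ k} ‖Dʲf‖_∞ + [Dᵏf]_r`
in the form `‖B(f,g)‖_{k,r} ≤ 3ᵏ ‖B‖ ∑_{j ≤ k} ‖f‖_{j,r} ‖g‖_{k-j,r}`, in which BOTH factors carry
the Hölder exponent `r`. That form is not tame-compatible: each product has total smoothness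
`k + 2r`, so it cannot be interpolated back into `‖·‖_{k,r}` (Buckmaster–De Lellis–Székelyhidi–
Vicol 2019, App. A: (A.2) `[fg]_r ≤ C([f]_r‖g‖₀ + ‖f‖₀[g]_r)` is the sharp form, and its
iterates are what the tame estimates of App. C–D consume). This file proves the **sharp form at
every order**,

  `‖B(f,g)‖_{k,r} ≤ 3ᵏ ‖B‖ ∑_{j ≤ k} (‖f‖_{j,r} ‖g‖_{k-j,0} + ‖f‖_{j,0} ‖g‖_{k-j,r})`

(`eContDiffHolderNorm_bilinear_le_sharp`, and its torus version), by the same induction on `k`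
as the non-sharp one (`‖h‖_{k+1,r} = ‖h‖_∞ + ‖Dh‖_{k,r}`, `D(B(f,g)) = B(f,Dg) + B(Df,g)` with
`precompR/precompL` of norm `≤ ‖B‖`), the base case being Gilbarg–Trudinger (4.7)
`[B(f,g)]_r ≤ ‖B‖([f]_r‖g‖_∞ + ‖f‖_∞[g]_r)` (`eHolderNorm_bilinear_le`). Here `‖g‖_{m,0}` is the
accepted `C^{m,0}` norm (Mathlib's `0`-Hölder seminorm is the oscillation, so
`∑_{i≤m}‖Dⁱg‖_∞ ≤ ‖g‖_{m,0} ≤ 3 ∑_{i≤m}‖Dⁱg‖_∞`); every product on the right has total smoothness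
`k + r`, the form consumed by `Torus.eContDiffHolderNorm_mul_le_mixed_tame`.

## References

* T. Buckmaster, C. De Lellis, L. Székelyhidi Jr., V. Vicol, *Onsager's conjecture for admissible
  weak solutions*, CPAM 72 (2019) = arXiv:1701.08678, App. A (A.2). [`BuckmasterEtAl2018`]
* D. Gilbarg, N. Trudinger, *Elliptic PDE of second order* (2001), §4.1 (4.7).
-/

open Set Filter
open scoped NNReal ENNReal ContDiff

noncomputable section

universe u

set_option maxSynthPendingDepth 3

namespace Literature.Analysis.FunctionSpaces

section Leibniz

variable {E' Y₁ Y₂ Z : Type u} [NormedAddCommGroup E'] [NormedSpace ℝ E']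
  [NormedAddCommGroup Y₁] [NormedSpace ℝ Y₁] [NormedAddCommGroup Y₂] [NormedSpace ℝ Y₂]
  [NormedAddCommGroup Z] [NormedSpace ℝ Z]

/-- The case `k = 0` of the sharp Leibniz estimate:
`‖B(f,g)‖_{0,r} ≤ ‖B‖ (‖f‖_{0,r} ‖g‖_{0,0} + ‖f‖_{0,0} ‖g‖_{0,r})` (from
`[B(f,g)]_r ≤ ‖B‖([f]_r‖g‖_∞ + ‖f‖_∞[g]_r)` and `‖·‖_∞ ≤ ‖·‖_{0,0}`). [folklore] -/
theorem eContDiffHolderNorm_zero_bilinear_le_sharp (B : Y₁ →L[ℝ] Y₂ →L[ℝ] Z) (r : ℝ≥0)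
    (f : E' → Y₁) (g : E' → Y₂) :
    eContDiffHolderNorm 0 r (fun x => B (f x) (g x)) ≤
      ‖B‖ₑ * (eContDiffHolderNorm 0 r f * eContDiffHolderNorm 0 0 g +
        eContDiffHolderNorm 0 0 f * eContDiffHolderNorm 0 r g) := by
  have hg0 : eSupNorm g ≤ eContDiffHolderNorm 0 0 g := eSupNorm_le_eContDiffHolderNorm 0 0 g
  have hf0 : eSupNorm f ≤ eContDiffHolderNorm 0 0 f := eSupNorm_le_eContDiffHolderNorm 0 0 f
  rw [eContDiffHolderNorm_zero_eq, eContDiffHolderNorm_zero_eq r f, eContDiffHolderNorm_zero_eq r g]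
  calc eSupNorm (fun x => B (f x) (g x)) + eHolderNorm r (fun x => B (f x) (g x))
      ≤ ‖B‖ₑ * eSupNorm f * eSupNorm g +
          ‖B‖ₑ * (eHolderNorm r f * eSupNorm g + eSupNorm f * eHolderNorm r g) :=
        add_le_add (eSupNorm_bilinear_le B f g) (eHolderNorm_bilinear_le B r f g)
    _ = ‖B‖ₑ * ((eSupNorm f + eHolderNorm r f) * eSupNorm g + eSupNorm f * eHolderNorm r g) := by
        ring
    _ ≤ ‖B‖ₑ * ((eSupNorm f + eHolderNorm r f) * eContDiffHolderNorm 0 0 g +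
          eContDiffHolderNorm 0 0 f * (eSupNorm g + eHolderNorm r g)) :=
        mul_le_mul' le_rfl (add_le_add (mul_le_mul' le_rfl hg0)
          (mul_le_mul hf0 le_add_self bot_le bot_le))

/-- **Sharp Leibniz estimate in `C^{k,r}`** (BDSV App. A (A.2) iterated; only one factor carries
the Hölder exponent): for a continuous bilinear map `B` and `C^k` maps `f`, `g`,
`‖B(f,g)‖_{k,r} ≤ 3ᵏ ‖B‖ ∑_{j ≤ k} (‖f‖_{j,r} ‖g‖_{k-j,0} + ‖f‖_{j,0} ‖g‖_{k-j,r})`. Proof by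
induction on `k` exactly as `eContDiffHolderNorm_bilinear_le`. [folklore] -/
theorem eContDiffHolderNorm_bilinear_le_sharp (B : Y₁ →L[ℝ] Y₂ →L[ℝ] Z) {f : E' → Y₁} {g : E' → Y₂}
    {k : ℕ} (hf : ContDiff ℝ k f) (hg : ContDiff ℝ k g) (r : ℝ≥0) :
    eContDiffHolderNorm k r (fun x => B (f x) (g x)) ≤
      3 ^ k * ‖B‖ₑ * ∑ j ∈ Finset.range (k + 1),
        (eContDiffHolderNorm j r f * eContDiffHolderNorm (k - j) 0 g +
          eContDiffHolderNorm j 0 f * eContDiffHolderNorm (k - j) r g) := by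
  induction k generalizing Y₁ Y₂ Z with
  | zero =>
    simpa [mul_assoc] using eContDiffHolderNorm_zero_bilinear_le_sharp B r f g
  | succ k IH =>
    -- notation
    set T : ℕ → ℝ≥0∞ := fun j => eContDiffHolderNorm j r f * eContDiffHolderNorm (k + 1 - j) 0 g +
      eContDiffHolderNorm j 0 f * eContDiffHolderNorm (k + 1 - j) r g with hT
    set S : ℝ≥0∞ := ∑ j ∈ Finset.range (k + 1 + 1), T j with hS
    have hf' : ContDiff ℝ k f := hf.of_le (by exact_mod_cast Nat.le_succ k)
    have hg' : ContDiff ℝ k g := hg.of_le (by exact_mod_cast Nat.le_succ k)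
    have hDf : ContDiff ℝ k (fderiv ℝ f) := hf.fderiv_right (by exact_mod_cast le_rfl)
    have hDg : ContDiff ℝ k (fderiv ℝ g) := hg.fderiv_right (by exact_mod_cast le_rfl)
    -- the derivative of `B(f,g)`
    have hderiv : fderiv ℝ (fun x => B (f x) (g x)) =
        (fun x => B.precompR E' (f x) (fderiv ℝ g x)) + fun x => B.precompL E' (fderiv ℝ f x) (g x) := by
      funext x
      exact B.fderiv_of_bilinear ((hf.differentiable (by simp)) x) ((hg.differentiable (by simp)) x)
    have hP : ContDiff ℝ k (fun x => B.precompR E' (f x) (fderiv ℝ g x)) :=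
      (B.precompR E').isBoundedBilinearMap.contDiff.comp₂ hf' hDg
    have hQ : ContDiff ℝ k (fun x => B.precompL E' (fderiv ℝ f x) (g x)) :=
      (B.precompL E').isBoundedBilinearMap.contDiff.comp₂ hDf hg'
    -- the three partial bounds against `S`
    have h1 : ∑ j ∈ Finset.range (k + 1),
        (eContDiffHolderNorm j r f * eContDiffHolderNorm (k - j) 0 (fderiv ℝ g) +
          eContDiffHolderNorm j 0 f * eContDiffHolderNorm (k - j) r (fderiv ℝ g)) ≤ S := by
      rw [hS, Finset.sum_range_succ T (k + 1)]
      refine le_trans (Finset.sum_le_sum fun j hj => ?_) le_self_add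
      have hjk : j ≤ k := by simpa [Finset.mem_range, Nat.lt_succ_iff] using hj
      have : k + 1 - j = (k - j) + 1 := by omega
      simp only [hT, this]
      exact add_le_add (mul_le_mul' le_rfl (eContDiffHolderNorm_fderiv_le (k - j) 0 g))
        (mul_le_mul' le_rfl (eContDiffHolderNorm_fderiv_le (k - j) r g))
    have h2 : ∑ j ∈ Finset.range (k + 1),
        (eContDiffHolderNorm j r (fderiv ℝ f) * eContDiffHolderNorm (k - j) 0 g +
          eContDiffHolderNorm j 0 (fderiv ℝ f) * eContDiffHolderNorm (k - j) r g) ≤ S := by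
      rw [hS, Finset.sum_range_succ' T (k + 1)]
      refine le_trans (Finset.sum_le_sum fun j hj => ?_) le_self_add
      have : k + 1 - (j + 1) = k - j := by omega
      simp only [hT, this]
      exact add_le_add (mul_le_mul' (eContDiffHolderNorm_fderiv_le j r f) le_rfl)
        (mul_le_mul' (eContDiffHolderNorm_fderiv_le j 0 f) le_rfl)
    have h3 : eSupNorm f * eSupNorm g ≤ S := by
      rw [hS, Finset.sum_range_succ' T (k + 1)]
      refine le_trans ?_ le_add_self
      simp only [hT, Nat.sub_zero]
      refine le_trans ?_ le_self_add
      exact mul_le_mul (eSupNorm_le_eContDiffHolderNorm 0 r f)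
        (eSupNorm_le_eContDiffHolderNorm (k + 1) 0 g) bot_le bot_le
    -- norms of the auxiliary bilinear maps
    have hBR : ‖B.precompR E'‖ₑ ≤ ‖B‖ₑ := by
      rw [← ofReal_norm, ← ofReal_norm]
      exact ENNReal.ofReal_le_ofReal (B.norm_precompR_le E')
    have hBL : ‖B.precompL E'‖ₑ ≤ ‖B‖ₑ := by
      rw [← ofReal_norm, ← ofReal_norm]
      exact ENNReal.ofReal_le_ofReal (B.norm_precompL_le E')
    -- assemble
    calc eContDiffHolderNorm (k + 1) r (fun x => B (f x) (g x))
        = eSupNorm (fun x => B (f x) (g x)) +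
            eContDiffHolderNorm k r ((fun x => B.precompR E' (f x) (fderiv ℝ g x)) +
              fun x => B.precompL E' (fderiv ℝ f x) (g x)) := by
          rw [eContDiffHolderNorm_succ_eq_fderiv, hderiv]
      _ ≤ ‖B‖ₑ * eSupNorm f * eSupNorm g +
            (eContDiffHolderNorm k r (fun x => B.precompR E' (f x) (fderiv ℝ g x)) +
              eContDiffHolderNorm k r (fun x => B.precompL E' (fderiv ℝ f x) (g x))) :=
          add_le_add (eSupNorm_bilinear_le B f g) (eContDiffHolderNorm_add_le hP hQ)
      _ ≤ ‖B‖ₑ * S + (3 ^ k * ‖B‖ₑ * S + 3 ^ k * ‖B‖ₑ * S) := by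
          refine add_le_add ?_ (add_le_add ?_ ?_)
          · rw [mul_assoc]
            exact mul_le_mul' le_rfl h3
          · refine (IH (B.precompR E') hf' hDg).trans ?_
            exact mul_le_mul' (mul_le_mul' le_rfl hBR) h1
          · refine (IH (B.precompL E') hDf hg').trans ?_
            exact mul_le_mul' (mul_le_mul' le_rfl hBL) h2
      _ = (1 + 2 * 3 ^ k) * ‖B‖ₑ * S := by ring
      _ ≤ 3 ^ (k + 1) * ‖B‖ₑ * S := by
          gcongr
          rw [pow_succ]
          have h13 : (1 : ℝ≥0∞) ≤ 3 ^ k := one_le_pow₀ (by norm_num)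
          calc (1 : ℝ≥0∞) + 2 * 3 ^ k ≤ 3 ^ k + 2 * 3 ^ k := add_le_add h13 le_rfl
            _ = 3 ^ k * 3 := by ring

end Leibniz

/-! ## The torus version -/

namespace Torus

variable {d : Type u} [Fintype d] {Y₁ Y₂ Z : Type u} [NormedAddCommGroup Y₁] [NormedSpace ℝ Y₁]
  [NormedAddCommGroup Y₂] [NormedSpace ℝ Y₂] [NormedAddCommGroup Z] [NormedSpace ℝ Z]
variable {k : ℕ}

/-- **Sharp Leibniz estimate on the torus**:
`‖B(f,g)‖_{C^{k,r}} ≤ 3ᵏ ‖B‖ ∑_{j ≤ k} (‖f‖_{j,r} ‖g‖_{k-j,0} + ‖f‖_{j,0} ‖g‖_{k-j,r})` for `C^k`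
maps `f, g` on `T^d` and a continuous bilinear `B` (the norms being those of the periodic
lifts). [folklore] -/
theorem eContDiffHolderNorm_bilinear_le_sharp (B : Y₁ →L[ℝ] Y₂ →L[ℝ] Z) {f : UnitAddTorus d → Y₁}
    {g : UnitAddTorus d → Y₂} (hf : IsContDiff k f) (hg : IsContDiff k g) (r : ℝ≥0) :
    Torus.eContDiffHolderNorm k r (fun x => B (f x) (g x)) ≤
      3 ^ k * ‖B‖ₑ * ∑ j ∈ Finset.range (k + 1),
        (Torus.eContDiffHolderNorm j r f * Torus.eContDiffHolderNorm (k - j) 0 g +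
          Torus.eContDiffHolderNorm j 0 f * Torus.eContDiffHolderNorm (k - j) r g) :=
  FunctionSpaces.eContDiffHolderNorm_bilinear_le_sharp B hf hg r

end Torus

/-! ## Real products and scalar multiples on the torus -/

namespace Torus

variable {d : Type} [Fintype d] {Z : Type} [NormedAddCommGroup Z] [NormedSpace ℝ Z]
variable {k : ℕ}

/-- The sharp Leibniz estimate for **real products** on the torus (`B` = multiplication, `‖B‖ ≤ 1`):
`‖f g‖_{C^{k,r}} ≤ 3ᵏ ∑_{j ≤ k} (‖f‖_{j,r} ‖g‖_{k-j,0} + ‖f‖_{j,0} ‖g‖_{k-j,r})`. [folklore] -/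
theorem eContDiffHolderNorm_mul_le_sharp {f g : UnitAddTorus d → ℝ} (hf : IsContDiff k f)
    (hg : IsContDiff k g) (r : ℝ≥0) :
    Torus.eContDiffHolderNorm k r (fun x => f x * g x) ≤
      3 ^ k * ∑ j ∈ Finset.range (k + 1),
        (Torus.eContDiffHolderNorm j r f * Torus.eContDiffHolderNorm (k - j) 0 g +
          Torus.eContDiffHolderNorm j 0 f * Torus.eContDiffHolderNorm (k - j) r g) := by
  have h := eContDiffHolderNorm_bilinear_le_sharp (ContinuousLinearMap.mul ℝ ℝ) hf hg r
  have hB : ‖(ContinuousLinearMap.mul ℝ ℝ : ℝ →L[ℝ] ℝ →L[ℝ] ℝ)‖ₑ ≤ 1 := by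
    rw [enorm_eq_nnnorm, ← ENNReal.coe_one, ENNReal.coe_le_coe, ← NNReal.coe_le_coe, coe_nnnorm,
      NNReal.coe_one]
    exact ContinuousLinearMap.opNorm_mul_le ℝ ℝ
  simp only [ContinuousLinearMap.mul_apply'] at h
  refine h.trans ?_
  calc 3 ^ k * ‖(ContinuousLinearMap.mul ℝ ℝ : ℝ →L[ℝ] ℝ →L[ℝ] ℝ)‖ₑ * _ ≤ 3 ^ k * 1 * _ := by
        gcongr
    _ = _ := by rw [mul_one]

/-- The sharp Leibniz estimate for **scalar multiples** on the torus (`B` = `smul`, `‖B‖ ≤ 1`):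
`‖f • g‖_{C^{k,r}} ≤ 3ᵏ ∑_{j ≤ k} (‖f‖_{j,r} ‖g‖_{k-j,0} + ‖f‖_{j,0} ‖g‖_{k-j,r})`. [folklore] -/
theorem eContDiffHolderNorm_smul_le_sharp {f : UnitAddTorus d → ℝ} {g : UnitAddTorus d → Z}
    (hf : IsContDiff k f) (hg : IsContDiff k g) (r : ℝ≥0) :
    Torus.eContDiffHolderNorm k r (fun x => f x • g x) ≤
      3 ^ k * ∑ j ∈ Finset.range (k + 1),
        (Torus.eContDiffHolderNorm j r f * Torus.eContDiffHolderNorm (k - j) 0 g +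
          Torus.eContDiffHolderNorm j 0 f * Torus.eContDiffHolderNorm (k - j) r g) := by
  have h := eContDiffHolderNorm_bilinear_le_sharp (ContinuousLinearMap.lsmul ℝ ℝ : ℝ →L[ℝ] Z →L[ℝ] Z)
    hf hg r
  have hB : ‖(ContinuousLinearMap.lsmul ℝ ℝ : ℝ →L[ℝ] Z →L[ℝ] Z)‖ₑ ≤ 1 := by
    rw [enorm_eq_nnnorm, ← ENNReal.coe_one, ENNReal.coe_le_coe, ← NNReal.coe_le_coe, coe_nnnorm,
      NNReal.coe_one]
    exact ContinuousLinearMap.opNorm_lsmul_le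
  simp only [ContinuousLinearMap.lsmul_apply] at h
  refine h.trans ?_
  calc 3 ^ k * ‖(ContinuousLinearMap.lsmul ℝ ℝ : ℝ →L[ℝ] Z →L[ℝ] Z)‖ₑ * _ ≤ 3 ^ k * 1 * _ := by
        gcongr
    _ = _ := by rw [mul_one]

end Torus

end Literature.Analysis.FunctionSpaces
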